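import Summits.QuantumFields.BalabanUV.Beta.FP.TorusNestedReadoutRows

/-!
# `BalabanUV.Beta.FP.TorusNestedReadoutLocality` — road «FP», binder row D1, ROUTE T (β1), STUB P (P-b) of the row's ONE file, part 2 of 2 (an2 g76 A-2 l.68669 (3) ∕
# W-3 l.68674 «R-AN2-76-PB»; road W-3 l.68665 (ii)(a), W-5 l.68675; J-NOTE-20 §6∕§8): **THE NESTED-SLICE GAUGE READ-OUT `E·(N·W₀)⁻¹·N` IS BIG-BLOCK-LOCAL** —
# (L2) the tower generator columns, (L3) the evaluation matrix, `N·W₀` BLOCK-DIAGONAL over the big blocks, hence its inverse, hence the read-out; the wrapper-shaped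
# corollary for v10's `hlve` ∕ g53 (D)'s equation form (generic step-row family `Q : StepRows d Lc` under the displayed two-block letter (TB) of part 1)

WHY.  See part 1 `FP/TorusNestedReadoutRows`.  With `N := fromRows (τ₂·Q₁₀) τ₁` (a letter typed SQUARE against `W₀`, pinned `hN : N = fromRows (τ₂ * Q₁₀) τ₁`
— the `NParam … (n+1)` ∕ `Res ⊕ NParam … n` row types agree by unfolding, so `hN := rfl`-class at the wrapper and (D)'s ∕ leaf-06 G-2's `fromRows (τ₂ * Q₁₀) τ₁ * W₀`
instantiate the letters), `W₀ := towerGen Lc M rs (n+1)`, `E := towerEvalC Lc M rs hrs (n+1)`, the big block of a slot `γ p := quo (bigRatio Lc (n+1)) ((towerEquiv …).symm p).site`: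
§3 **(L2) `towerGen_apply_ne_zero`**: `W₀ b p ≠ 0 → ↑b.1 + e_{b.2} ∈ pbox T → γ p = quo L ↑b.1 ∨ γ p = quo L (↑b.1 + e_{b.2})` (induction on the depth; `tgradBlock_inl ∕
tgrad_inl` read two periodic indicators, `tdelta_of_mem` — the boundary leak of the block-constant modes is exactly the excluded WRAPPING case, which (L1) shows is never
read); §4 **(L3) `towerEvalC_apply_ne_zero`**: `E p q ≠ 0 → γ p = γ q` (induction over `evalC = fromBlocks 1 0 E 1`, `E s t̄ = [quo N s = t̄]`, the lower factor sorted by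
`lowerSort`; `quo_towerEquiv_symm_lowerSort`); §5 **`nestedRows_mul_towerGen_apply_eq_zero`** (`γ p ≠ γ q → (N·W₀) p q = 0`: (L1) + `mem_pbox_of_quo_eq` + (L2)),
**`readout_apply_ne_zero`** (`(E·(N·W₀)⁻¹·N) p b ≠ 0 → quo L ↑b.1 = γ p ∧ quo L (↑b.1 + e_{b.2}) = γ p`: (L3), part 1 §0's block-diagonal inverse, (L1)),
**`readout_mulVec_apply_congr`** (the read-out at `p` depends on the column only through the bonds of `p`'s big block), and AT THE WRAPPER's SHAPE
**`treeGauge_readout_congr`**: from `det (N·W₀) ≠ 0` (leaf-06 G-2 `torus_hTW_oneShot_towerSym`), `(N·W₀)·θ = −N·X`, `(N·W₀)·θ′ = −N·X′` ((D) §2's conclusion shape) and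
`X = X′` on the bonds of the big block of the finest site `s`: `Σ_x [x = s]·(E·θ)(towerEquiv x) = Σ_x [x = s]·(E·θ′)(towerEquiv x)` — v10's `hlve` word.
[folklore] finite `Matrix` ∕ floor-division bookkeeping over OUR torus objects; no `def`, no `def … : Prop`, nothing cited, 0 sorry, default heartbeats.
WHAT THIS IS NOT: (TB) stays displayed here (discharged at the record's `QSym Lc` in `FP/QstepSymTwoBlock`); not (P-c) (the lattice twin `λℤ`, its `Mc B`-periodisation
= `lv` — the row's); not the VALUE identification «block of the general-box read-out = reference-torus read-out» (J-NOTE-20 §8; next file of this lineage — the support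
theorem here is what makes it a finite `submatrix` identity); no row of v9∕v10 discharged; `hlve` NOT instantiated; nothing of Bałaban's asserted, valued or discharged;
0 estimates; 0∕4 row-D1 binders (hW, hR, D1Tel, D1Rep); ROOT M‴ p325680 untouched; NOT (C1), NOT (L2′), NOT (T-ID), NOT SDF, NOT D1, NEVER «G-an2-4 closed», NOT
BetaPertH, NOT continuum, NOT Clay.

HONEST DEPENDENCY (page 1, mandatory): continuum YM on T⁴ ⇐ BetaPertH ∧ nine spine estimates (0/9 proved); BetaPertH ⇐ (D1) ∧ (D4) ∧ CAP+tail;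
G-an2-4 gates asym, D1 and NE2/3/4.  HONEST FRAMING (cell contract, verbatim): «discharging `BetaPertH` makes Bałaban's UV stability UNCONDITIONAL —
a real constructive-QFT result; it is NOT the continuum limit and NOT the Clay problem.»  ABSOLUTE RULE (cell charter, verbatim): «No internally-minted
statement may enter as a cited fact. Every hypothesis is either kernel-proved in this package or a verbatim quotation of a PUBLISHED theorem with page
reference. The manuscript(s) under audit are NOT citable for their own disputed steps — they are the thing under adjudication; programme-internal
(2001/route/tribunal) claims are never citable.»  Road «FP» OWNER, b2b-balaban-beta-d1-p3 gen 54, 2026-08-29.  No existing file touched.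
-/

noncomputable section

namespace Summit.QuantumFields.BalabanUV.Beta.FP.TorusNestedReadoutLocality

open Matrix Finset
open scoped BigOperators
open Literature.MathematicalPhysics.QuantumFieldTheory
open Literature.MathematicalPhysics.QuantumFieldTheory.Balaban1983to89
open Literature.MathematicalPhysics.QuantumFieldTheory.Balaban1983to89.Beta
open B5Prop11Plancherel (fine)
open B6Lemma24Torus (pbox mem_pbox)
open AffineAveraging (Site toSite unitVec)
open OneStepResolventKernel (Fib)
open Literature.MathematicalPhysics.QuantumFieldTheory.LatticeForm (quo)
open Summit.QuantumFields.BalabanUV.Beta.FP.KernelPeriodisationFib (Idx)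
open Summit.QuantumFields.BalabanUV.Beta.FP.TorusGaugeCovariance (tgrad tgrad_inl tdelta tdelta_of_mem)
open Summit.QuantumFields.BalabanUV.Beta.FP.TorusGaugeCovarianceCoarse (tgradBlock tgradBlock_inl)
open Summit.QuantumFields.BalabanUV.Beta.FP.TorusCombRows (Res)
open Summit.QuantumFields.BalabanUV.Beta.FP.TorusCombNestedBasis (evalC evalE quo_mem_pbox)
open Summit.QuantumFields.BalabanUV.Beta.FP.TorusCompositeObjects
open Summit.QuantumFields.BalabanUV.Beta.FP.TorusCompositeObjectsG (StepRows compRowsG)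
open Summit.QuantumFields.BalabanUV.Beta.FP.TorusCompositeUnimodular (towerEvalC lowerSort bigRatio_dvd_towerTorus)
open Summit.QuantumFields.BalabanUV.Beta.FP.TorusNestedReadoutRows
open Summit.QuantumFields.BalabanUV.Beta.GAN24.StaircaseFaces (quo_quo)

variable {d : ℕ}

/-! ## §3 (L2) The support of the tower generator columns: a non-wrapping bond moved by slot `p`'s mode has an endpoint in `p`'s big block -/

section Generators

variable (Lc : ℕ) [NeZero Lc]

/-- [folklore] **(L2) — SUPPORT OF THE TOWER GENERATOR COLUMNS**: if `W₀ b p ≠ 0` and the bond `b` does not wrap around the finest torus, then the big block of `p`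
is the big block of one of `b`'s endpoints (induction on the depth: `tgradBlock_inl ∕ tgrad_inl` read two periodic indicators, `tdelta_of_mem` — the boundary
leak of the block-constant modes is exactly the excluded wrapping case). -/
theorem towerGen_apply_ne_zero : ∀ (k : ℕ) (M : Fin (d + 1) → ℕ) [∀ μ, NeZero (M μ)] (rs : ℕ → (Fin (d + 1) → ℕ))
    (hrs : ∀ j i, 0 ≤ toSite (rs j) i ∧ toSite (rs j) i < (Lc : ℤ))
    (b : ↥(pbox (towerTorus Lc M k)) × Fin (d + 1)) (p : NParam Lc M rs k),
    towerGen Lc M rs k b p ≠ 0 → (b.1 : Site (d + 1)) + unitVec b.2 ∈ pbox (towerTorus Lc M k) →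
      quo (bigRatio Lc k) ((towerEquiv Lc M rs hrs k).symm p).site = quo (bigRatio Lc k) (b.1 : Site (d + 1)) ∨
      quo (bigRatio Lc k) ((towerEquiv Lc M rs hrs k).symm p).site = quo (bigRatio Lc k) ((b.1 : Site (d + 1)) + unitVec b.2)
  | 0, M, _, rs, hrs, b, p, h, hb => by
    rw [towerGen_zero, Matrix.submatrix_apply, tgrad_inl, tdelta_of_mem M (show (b.1 : Site (d + 1)) + unitVec b.2 ∈ pbox M from hb),
      tdelta_of_mem M (show ((b.1 : ↥(pbox (towerTorus Lc M 0))) : Site (d + 1)) ∈ pbox M from b.1.2)] at h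
    have hp : ((towerEquiv Lc M rs hrs 0).symm p).site = ((p.1 : ↥(pbox M)) : Site (d + 1)) := rfl
    rw [hp]
    by_cases e1 : (b.1 : Site (d + 1)) + unitVec b.2 = ((p.1 : ↥(pbox M)) : Site (d + 1))
    · right; rw [e1]
    · by_cases e2 : ((b.1 : ↥(pbox M)) : Site (d + 1)) = ((p.1 : ↥(pbox M)) : Site (d + 1))
      · left; rw [e2]
      · rw [if_neg e1, if_neg e2, sub_zero] at h; exact absurd rfl h
  | k + 1, M, _, rs, hrs, b, p, h, hb => by
    have hLc : 0 < Lc := Nat.pos_of_ne_zero (NeZero.ne Lc)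
    have hR : 0 < bigRatio Lc k := bigRatio_pos Lc hLc k
    rw [towerGen_succ] at h
    rcases p with t | x
    · have h' : tgradBlock M (bigRatio Lc k) ((pboxCongr (towerTorus_fine_eq_fine Lc M k) b.1 : ↥(pbox (fine (bigRatio Lc k) M))), Sum.inl b.2)
          (t.1 : ↥(pbox M)) ≠ 0 := h
      clear h
      rw [tgradBlock_inl, pboxCongr_coe] at h'
      have hT : towerTorus Lc (fine Lc M) k = fine (bigRatio Lc k) M := towerTorus_fine_eq_fine Lc M k
      have hq1 : quo (bigRatio Lc k) (b.1 : Site (d + 1)) ∈ pbox M := quo_mem_pbox hR (by rw [← hT]; exact b.1.2)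
      have hq2 : quo (bigRatio Lc k) ((b.1 : Site (d + 1)) + unitVec b.2) ∈ pbox M := quo_mem_pbox hR (by rw [← hT]; exact hb)
      rw [tdelta_of_mem _ hq2, tdelta_of_mem _ hq1] at h'
      rw [quo_towerEquiv_symm_inl, bigRatio_succ, ← quo_quo (bigRatio Lc k), ← quo_quo (bigRatio Lc k)]
      by_cases e1 : quo (bigRatio Lc k) ((b.1 : Site (d + 1)) + unitVec b.2) = ((t.1 : ↥(pbox M)) : Site (d + 1))
      · right; rw [e1]
      · by_cases e2 : quo (bigRatio Lc k) (b.1 : Site (d + 1)) = ((t.1 : ↥(pbox M)) : Site (d + 1))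
        · left; rw [e2]
        · rw [if_neg e1, if_neg e2, sub_zero] at h'; exact absurd rfl h'
    · have h' : towerGen Lc (fine Lc M) (fun j => rs (j + 1)) k b x ≠ 0 := h
      have ih := towerGen_apply_ne_zero k (fine Lc M) (fun j => rs (j + 1)) (fun j => hrs (j + 1)) b x h' hb
      rw [quo_towerEquiv_symm_inr, bigRatio_succ, ← quo_quo (bigRatio Lc k), ← quo_quo (bigRatio Lc k)]
      rcases ih with e | e
      · left; rw [e]
      · right; rw [e]

end Generators

/-! ## §4 (L3) The tower evaluation matrix is block-diagonal over the big blocks -/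

section Eval

variable (Lc : ℕ) [NeZero Lc]

/-- [folklore] the big block of a single-shot coordinate `Res_top ⊕ Res_lowbig` sorted by `lowerSort`: `quo Lc t̄` on the top summand, the `Lc`-block of the
lower big block on the lower summand. -/
theorem quo_towerEquiv_symm_lowerSort (M : Fin (d + 1) → ℕ) (rs : ℕ → (Fin (d + 1) → ℕ)) (hrs : ∀ j i, 0 ≤ toSite (rs j) i ∧ toSite (rs j) i < (Lc : ℤ))
    (k : ℕ) (i : Res (toSite (rs 0)) Lc M ⊕ Res (bigRoot Lc (fun j => rs (j + 1)) k) (bigRatio Lc k) (fine (bigRatio Lc k) M)) :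
    quo (bigRatio Lc (k + 1)) ((towerEquiv Lc M rs hrs (k + 1)).symm (lowerSort Lc M rs hrs k i)).site
      = Sum.elim (fun t : Res (toSite (rs 0)) Lc M => quo Lc t.site)
          (fun s : Res (bigRoot Lc (fun j => rs (j + 1)) k) (bigRatio Lc k) (fine (bigRatio Lc k) M) => quo Lc (quo (bigRatio Lc k) s.site)) i := by
  rcases i with t | s
  · exact quo_towerEquiv_symm_inl Lc M rs hrs k t
  · show quo (bigRatio Lc (k + 1)) ((towerEquiv Lc M rs hrs (k + 1)).symm (Sum.inr (((resCongr (towerTorus_fine_eq_fine Lc M k).symm).trans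
        (towerEquiv Lc (fine Lc M) (fun j => rs (j + 1)) (fun j => hrs (j + 1)) k)) s))).site = quo Lc (quo (bigRatio Lc k) s.site)
    rw [quo_towerEquiv_symm_inr, Equiv.trans_apply, Equiv.symm_apply_apply, resCongr_site]

/-- [folklore] **(L3) — `towerEvalC p q ≠ 0 ⟹ p, q IN THE SAME BIG BLOCK`** (induction on the depth: `evalC = fromBlocks 1 0 E 1` with `E s t̄ = [quo N s = t̄]` reads the
sub-block's own coarse index; the lower factor is the lower evaluation matrix, sorted). -/
theorem towerEvalC_apply_ne_zero : ∀ (k : ℕ) (M : Fin (d + 1) → ℕ) (rs : ℕ → (Fin (d + 1) → ℕ))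
    (hrs : ∀ j i, 0 ≤ toSite (rs j) i ∧ toSite (rs j) i < (Lc : ℤ)) (p q : NParam Lc M rs k),
    towerEvalC Lc M rs hrs k p q ≠ 0 →
      quo (bigRatio Lc k) ((towerEquiv Lc M rs hrs k).symm p).site = quo (bigRatio Lc k) ((towerEquiv Lc M rs hrs k).symm q).site
  | 0, M, rs, hrs, p, q, h => by
    have hpq : p = q := by
      by_contra hne
      exact h (by rw [show towerEvalC Lc M rs hrs 0 = 1 from rfl, Matrix.one_apply_ne hne])
    rw [hpq]
  | k + 1, M, rs, hrs, p, q, h => by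
    rw [towerEvalC, Matrix.submatrix_apply] at h
    obtain ⟨j, h1, h2⟩ := exists_of_mul_apply_ne_zero _ _ _ _ h
    rw [← (lowerSort Lc M rs hrs k).apply_symm_apply p, ← (lowerSort Lc M rs hrs k).apply_symm_apply q,
      quo_towerEquiv_symm_lowerSort, quo_towerEquiv_symm_lowerSort]
    generalize (lowerSort Lc M rs hrs k).symm p = i at h1
    generalize (lowerSort Lc M rs hrs k).symm q = i' at h2
    have hA : Sum.elim (fun t : Res (toSite (rs 0)) Lc M => quo Lc t.site)
          (fun s : Res (bigRoot Lc (fun j => rs (j + 1)) k) (bigRatio Lc k) (fine (bigRatio Lc k) M) => quo Lc (quo (bigRatio Lc k) s.site)) i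
        = Sum.elim (fun t : Res (toSite (rs 0)) Lc M => quo Lc t.site)
          (fun s : Res (bigRoot Lc (fun j => rs (j + 1)) k) (bigRatio Lc k) (fine (bigRatio Lc k) M) => quo Lc (quo (bigRatio Lc k) s.site)) j := by
      rcases i with t | s <;> rcases j with t' | s'
      · rw [evalC, Matrix.fromBlocks_apply₁₁] at h1
        have e : t = t' := by by_contra hne; exact h1 (Matrix.one_apply_ne hne)
        rw [e]
      · rw [evalC, Matrix.fromBlocks_apply₁₂] at h1; exact absurd rfl h1
      · rw [evalC, Matrix.fromBlocks_apply₂₁] at h1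
        simp only [evalE] at h1
        split_ifs at h1 with e
        · simp only [Sum.elim_inl, Sum.elim_inr]; rw [e]
        · exact absurd rfl h1
      · rw [evalC, Matrix.fromBlocks_apply₂₂] at h1
        have e : s = s' := by by_contra hne; exact h1 (Matrix.one_apply_ne hne)
        rw [e]
    have hB : Sum.elim (fun t : Res (toSite (rs 0)) Lc M => quo Lc t.site)
          (fun s : Res (bigRoot Lc (fun j => rs (j + 1)) k) (bigRatio Lc k) (fine (bigRatio Lc k) M) => quo Lc (quo (bigRatio Lc k) s.site)) j
        = Sum.elim (fun t : Res (toSite (rs 0)) Lc M => quo Lc t.site)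
          (fun s : Res (bigRoot Lc (fun j => rs (j + 1)) k) (bigRatio Lc k) (fine (bigRatio Lc k) M) => quo Lc (quo (bigRatio Lc k) s.site)) i' := by
      rcases j with t | s <;> rcases i' with t' | s'
      · rw [Matrix.fromBlocks_apply₁₁] at h2
        have e : t = t' := by by_contra hne; exact h2 (Matrix.one_apply_ne hne)
        rw [e]
      · rw [Matrix.fromBlocks_apply₁₂] at h2; exact absurd rfl h2
      · rw [Matrix.fromBlocks_apply₂₁] at h2; exact absurd rfl h2
      · rw [Matrix.fromBlocks_apply₂₂, Matrix.submatrix_apply] at h2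
        have ih := towerEvalC_apply_ne_zero k (fine Lc M) (fun j => rs (j + 1)) (fun j => hrs (j + 1)) _ _ h2
        rw [Equiv.trans_apply, Equiv.trans_apply, Equiv.symm_apply_apply, Equiv.symm_apply_apply, resCongr_site, resCongr_site] at ih
        simp only [Sum.elim_inr]
        rw [ih]
    exact hA.trans hB

end Eval

/-! ## §5 `N·W₀` is block-diagonal over the big blocks; so is its inverse; the read-out `E·(N·W₀)⁻¹·N` is big-block-local -/

section Readout

variable (Lc : ℕ) [NeZero Lc] (Q : StepRows d Lc)
  (hQ : ∀ (M : Fin (d + 1) → ℕ) [∀ μ, NeZero (M μ)] (ℓ : ℕ) (r : Fin (d + 1) → ℕ) (a : ↥(pbox M)) (ν : Fin (d + 1))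
      (b : ↥(pbox (fine Lc M))) (κ : Fin (d + 1)),
      (a : Site (d + 1)) + unitVec ν ∈ pbox M → Q M ℓ r (a, ν) (b, κ) ≠ 0 →
        (quo Lc (b : Site (d + 1)) = a ∨ quo Lc (b : Site (d + 1)) = (a : Site (d + 1)) + unitVec ν) ∧
        (quo Lc ((b : Site (d + 1)) + unitVec κ) = a ∨ quo Lc ((b : Site (d + 1)) + unitVec κ) = (a : Site (d + 1)) + unitVec ν))
  (M : Fin (d + 1) → ℕ) [∀ μ, NeZero (M μ)] (lev : ℕ → ℕ) (rs : ℕ → (Fin (d + 1) → ℕ))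
  (hrs : ∀ k i, 0 ≤ toSite (rs k) i ∧ toSite (rs k) i < (Lc : ℤ)) (hM : ∀ i, Lc ∣ M i) (n : ℕ)
include hQ hM

/-- [folklore] **`N·W₀` IS BLOCK-DIAGONAL OVER THE BIG BLOCKS** (`N = fromRows (τ₂·Q₁₀) τ₁` the nested slice of the wrapper — a letter `N` typed SQUARE against
`W₀ = towerGen`, pinned by `hN`): the entry `(p, q)` vanishes unless `p` and `q` lie in the same big block — (L1): row `p` reads only bonds with both endpoints in
`p`'s block (so never a wrapping bond); (L2): such a bond is moved only by the modes of slots of that block. -/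
theorem nestedRows_mul_towerGen_apply_eq_zero
    {Q₁₀ : Matrix (↥(pbox M) × Fin (d + 1)) (↥(pbox (towerTorus Lc M (n + 1))) × Fin (d + 1)) ℝ} (hQ₁₀ : Q₁₀ = compRowsG Lc Q M lev rs (n + 1))
    {τ₁ : Matrix (NParam Lc (fine Lc M) (fun k => rs (k + 1)) n) (↥(pbox (towerTorus Lc M (n + 1))) × Fin (d + 1)) ℝ}
    (hτ₁ : τ₁ = bigP Lc (fine Lc M) (fun k => rs (k + 1)) (fun k => hrs (k + 1)) n)
    {τ₂ : Matrix (Res (toSite (rs 0)) Lc M) (↥(pbox M) × Fin (d + 1)) ℝ} (hτ₂ : τ₂ = combF Lc M (rs 0))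
    {N : Matrix (NParam Lc M rs (n + 1)) (↥(pbox (towerTorus Lc M (n + 1))) × Fin (d + 1)) ℝ} (hN : N = Matrix.fromRows (τ₂ * Q₁₀) τ₁)
    {W₀ : Matrix (↥(pbox (towerTorus Lc M (n + 1))) × Fin (d + 1)) (NParam Lc M rs (n + 1)) ℝ} (hW₀ : W₀ = towerGen Lc M rs (n + 1))
    (p q : NParam Lc M rs (n + 1))
    (hpq : quo (bigRatio Lc (n + 1)) ((towerEquiv Lc M rs hrs (n + 1)).symm p).site ≠ quo (bigRatio Lc (n + 1)) ((towerEquiv Lc M rs hrs (n + 1)).symm q).site) :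
    (N * W₀) p q = 0 := by
  have hLc : 0 < Lc := Nat.pos_of_ne_zero (NeZero.ne Lc)
  subst hQ₁₀ hτ₁ hτ₂ hN hW₀
  by_contra h
  obtain ⟨b, h1, h2⟩ := exists_of_mul_apply_ne_zero _ _ _ _ h
  obtain ⟨hb1, hb2⟩ := nestedRows_apply_ne_zero Lc Q hQ M lev rs hrs hM n p b h1
  have hbt : (b.1 : Site (d + 1)) + unitVec b.2 ∈ pbox (towerTorus Lc M (n + 1)) :=
    mem_pbox_of_quo_eq (bigRatio_pos Lc hLc (n + 1)) (bigRatio_dvd_towerTorus Lc hM (n + 1)) ((towerEquiv Lc M rs hrs (n + 1)).symm p).mem hb2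
  rcases towerGen_apply_ne_zero Lc (n + 1) M rs hrs b q h2 hbt with e | e
  · exact hpq (hb1.symm.trans e.symm)
  · exact hpq (hb2.symm.trans e.symm)

/-- [folklore] **STUB P (P-b) — THE NESTED-SLICE GAUGE READ-OUT IS BIG-BLOCK-LOCAL (support form)**: with `N = fromRows (τ₂·Q₁₀) τ₁`, `W₀ = towerGen`, `E = towerEvalC`,
every nonzero entry `(E·(N·W₀)⁻¹·N) p b` has BOTH endpoints of the finest bond `b` (tip unwrapped) in the big block `quo (bigRatio Lc (n+1)) (site of p)` of the slot `p`
— (L3) for `E`, the block-diagonal inverse (§0; Mathlib's `⁻¹`, no invertibility used) of the block-diagonal `N·W₀`, and (L1) for `N`. -/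
theorem readout_apply_ne_zero
    {Q₁₀ : Matrix (↥(pbox M) × Fin (d + 1)) (↥(pbox (towerTorus Lc M (n + 1))) × Fin (d + 1)) ℝ} (hQ₁₀ : Q₁₀ = compRowsG Lc Q M lev rs (n + 1))
    {τ₁ : Matrix (NParam Lc (fine Lc M) (fun k => rs (k + 1)) n) (↥(pbox (towerTorus Lc M (n + 1))) × Fin (d + 1)) ℝ}
    (hτ₁ : τ₁ = bigP Lc (fine Lc M) (fun k => rs (k + 1)) (fun k => hrs (k + 1)) n)
    {τ₂ : Matrix (Res (toSite (rs 0)) Lc M) (↥(pbox M) × Fin (d + 1)) ℝ} (hτ₂ : τ₂ = combF Lc M (rs 0))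
    {N : Matrix (NParam Lc M rs (n + 1)) (↥(pbox (towerTorus Lc M (n + 1))) × Fin (d + 1)) ℝ} (hN : N = Matrix.fromRows (τ₂ * Q₁₀) τ₁)
    {W₀ : Matrix (↥(pbox (towerTorus Lc M (n + 1))) × Fin (d + 1)) (NParam Lc M rs (n + 1)) ℝ} (hW₀ : W₀ = towerGen Lc M rs (n + 1))
    {E : Matrix (NParam Lc M rs (n + 1)) (NParam Lc M rs (n + 1)) ℝ} (hE : E = towerEvalC Lc M rs hrs (n + 1))
    (p : NParam Lc M rs (n + 1)) (b : ↥(pbox (towerTorus Lc M (n + 1))) × Fin (d + 1)) (h : (E * (N * W₀)⁻¹ * N) p b ≠ 0) :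
    quo (bigRatio Lc (n + 1)) (b.1 : Site (d + 1)) = quo (bigRatio Lc (n + 1)) ((towerEquiv Lc M rs hrs (n + 1)).symm p).site ∧
      quo (bigRatio Lc (n + 1)) ((b.1 : Site (d + 1)) + unitVec b.2) = quo (bigRatio Lc (n + 1)) ((towerEquiv Lc M rs hrs (n + 1)).symm p).site := by
  obtain ⟨q, h12, h3⟩ := exists_of_mul_apply_ne_zero _ _ _ _ h
  obtain ⟨r, h1, h2⟩ := exists_of_mul_apply_ne_zero _ _ _ _ h12
  have e1 := towerEvalC_apply_ne_zero Lc (n + 1) M rs hrs p r (by rw [hE] at h1; exact h1)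
  have e2 : quo (bigRatio Lc (n + 1)) ((towerEquiv Lc M rs hrs (n + 1)).symm r).site
      = quo (bigRatio Lc (n + 1)) ((towerEquiv Lc M rs hrs (n + 1)).symm q).site := by
    by_contra hne
    exact h2 (inv_apply_eq_zero_of_blockDiagonal (fun x => quo (bigRatio Lc (n + 1)) ((towerEquiv Lc M rs hrs (n + 1)).symm x).site) _
      (fun x y hxy => nestedRows_mul_towerGen_apply_eq_zero Lc Q hQ M lev rs hrs hM n hQ₁₀ hτ₁ hτ₂ hN hW₀ x y hxy) r q hne)
  have e3 := nestedRows_apply_ne_zero Lc Q hQ M lev rs hrs hM n q b (by rw [hN, hQ₁₀, hτ₁, hτ₂] at h3; exact h3)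
  rw [e1, e2]
  exact e3

/-- [folklore] **STUB P (P-b), `mulVec` FORM**: the read-out `(E·(N·W₀)⁻¹·N) *ᵥ X` at slot `p` depends only on the column `X` restricted to the finest bonds with both
endpoints in `p`'s big block. -/
theorem readout_mulVec_apply_congr
    {Q₁₀ : Matrix (↥(pbox M) × Fin (d + 1)) (↥(pbox (towerTorus Lc M (n + 1))) × Fin (d + 1)) ℝ} (hQ₁₀ : Q₁₀ = compRowsG Lc Q M lev rs (n + 1))
    {τ₁ : Matrix (NParam Lc (fine Lc M) (fun k => rs (k + 1)) n) (↥(pbox (towerTorus Lc M (n + 1))) × Fin (d + 1)) ℝ}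
    (hτ₁ : τ₁ = bigP Lc (fine Lc M) (fun k => rs (k + 1)) (fun k => hrs (k + 1)) n)
    {τ₂ : Matrix (Res (toSite (rs 0)) Lc M) (↥(pbox M) × Fin (d + 1)) ℝ} (hτ₂ : τ₂ = combF Lc M (rs 0))
    {N : Matrix (NParam Lc M rs (n + 1)) (↥(pbox (towerTorus Lc M (n + 1))) × Fin (d + 1)) ℝ} (hN : N = Matrix.fromRows (τ₂ * Q₁₀) τ₁)
    {W₀ : Matrix (↥(pbox (towerTorus Lc M (n + 1))) × Fin (d + 1)) (NParam Lc M rs (n + 1)) ℝ} (hW₀ : W₀ = towerGen Lc M rs (n + 1))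
    {E : Matrix (NParam Lc M rs (n + 1)) (NParam Lc M rs (n + 1)) ℝ} (hE : E = towerEvalC Lc M rs hrs (n + 1))
    (p : NParam Lc M rs (n + 1)) (X X' : ↥(pbox (towerTorus Lc M (n + 1))) × Fin (d + 1) → ℝ)
    (hX : ∀ b : ↥(pbox (towerTorus Lc M (n + 1))) × Fin (d + 1),
      quo (bigRatio Lc (n + 1)) (b.1 : Site (d + 1)) = quo (bigRatio Lc (n + 1)) ((towerEquiv Lc M rs hrs (n + 1)).symm p).site →
      quo (bigRatio Lc (n + 1)) ((b.1 : Site (d + 1)) + unitVec b.2) = quo (bigRatio Lc (n + 1)) ((towerEquiv Lc M rs hrs (n + 1)).symm p).site →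
        X b = X' b) :
    ((E * (N * W₀)⁻¹ * N) *ᵥ X) p = ((E * (N * W₀)⁻¹ * N) *ᵥ X') p :=
  mulVec_apply_congr_of_support _ p X X' fun b hb =>
    (fun hq => hX b hq.1 hq.2) (readout_apply_ne_zero Lc Q hQ M lev rs hrs hM n hQ₁₀ hτ₁ hτ₂ hN hW₀ hE p b hb)

/-- [folklore] **STUB P (P-b) AT THE WRAPPER's SHAPE** (g53 (D) `gaugeParam_eq_neg_nestedReadout_sym` + leaf-06 G-2 `torus_hTW_oneShot_towerSym`, v10's `hlve`): if the gauge
parameters `θ, θ′` of two columns `X, X′` are determined by the nested slice — `(N·W₀)·θ = −N·X`, `(N·W₀)·θ′ = −N·X′`, `det (N·W₀) ≠ 0` — and `X, X′` agree on the finest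
bonds with both endpoints in the big block of the finest site `s`, then the tree-gauge read-outs at `s` agree:
`Σ_x [x = s]·(E·θ)(towerEquiv x) = Σ_x [x = s]·(E·θ′)(towerEquiv x)`. -/
theorem treeGauge_readout_congr
    {Q₁₀ : Matrix (↥(pbox M) × Fin (d + 1)) (↥(pbox (towerTorus Lc M (n + 1))) × Fin (d + 1)) ℝ} (hQ₁₀ : Q₁₀ = compRowsG Lc Q M lev rs (n + 1))
    {τ₁ : Matrix (NParam Lc (fine Lc M) (fun k => rs (k + 1)) n) (↥(pbox (towerTorus Lc M (n + 1))) × Fin (d + 1)) ℝ}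
    (hτ₁ : τ₁ = bigP Lc (fine Lc M) (fun k => rs (k + 1)) (fun k => hrs (k + 1)) n)
    {τ₂ : Matrix (Res (toSite (rs 0)) Lc M) (↥(pbox M) × Fin (d + 1)) ℝ} (hτ₂ : τ₂ = combF Lc M (rs 0))
    {N : Matrix (NParam Lc M rs (n + 1)) (↥(pbox (towerTorus Lc M (n + 1))) × Fin (d + 1)) ℝ} (hN : N = Matrix.fromRows (τ₂ * Q₁₀) τ₁)
    {W₀ : Matrix (↥(pbox (towerTorus Lc M (n + 1))) × Fin (d + 1)) (NParam Lc M rs (n + 1)) ℝ} (hW₀ : W₀ = towerGen Lc M rs (n + 1))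
    {E : Matrix (NParam Lc M rs (n + 1)) (NParam Lc M rs (n + 1)) ℝ} (hE : E = towerEvalC Lc M rs hrs (n + 1))
    (hTW : (N * W₀).det ≠ 0)
    {θ θ' : NParam Lc M rs (n + 1) → ℝ} {X X' : ↥(pbox (towerTorus Lc M (n + 1))) × Fin (d + 1) → ℝ}
    (hθ : (N * W₀) *ᵥ θ = -(N *ᵥ X)) (hθ' : (N * W₀) *ᵥ θ' = -(N *ᵥ X'))
    (s : ↥(pbox (towerTorus Lc M (n + 1))))
    (hX : ∀ b : ↥(pbox (towerTorus Lc M (n + 1))) × Fin (d + 1),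
      quo (bigRatio Lc (n + 1)) (b.1 : Site (d + 1)) = quo (bigRatio Lc (n + 1)) (s : Site (d + 1)) →
      quo (bigRatio Lc (n + 1)) ((b.1 : Site (d + 1)) + unitVec b.2) = quo (bigRatio Lc (n + 1)) (s : Site (d + 1)) → X b = X' b) :
    (∑ x : Res (bigRoot Lc rs (n + 1)) (bigRatio Lc (n + 1)) (towerTorus Lc M (n + 1)),
        (if (x.1 : ↥(pbox (towerTorus Lc M (n + 1)))) = s then (E *ᵥ θ) (towerEquiv Lc M rs hrs (n + 1) x) else 0))
      = ∑ x : Res (bigRoot Lc rs (n + 1)) (bigRatio Lc (n + 1)) (towerTorus Lc M (n + 1)),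
        (if (x.1 : ↥(pbox (towerTorus Lc M (n + 1)))) = s then (E *ᵥ θ') (towerEquiv Lc M rs hrs (n + 1) x) else 0) := by
  have hu : IsUnit (N * W₀).det := isUnit_iff_ne_zero.mpr hTW
  have solve : ∀ {t : NParam Lc M rs (n + 1) → ℝ} {Y : ↥(pbox (towerTorus Lc M (n + 1))) × Fin (d + 1) → ℝ},
      (N * W₀) *ᵥ t = -(N *ᵥ Y) → E *ᵥ t = -((E * (N * W₀)⁻¹ * N) *ᵥ Y) := by
    intro t Y ht
    have e : t = -((N * W₀)⁻¹ *ᵥ (N *ᵥ Y)) := by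
      rw [← Matrix.mulVec_neg, ← ht, Matrix.mulVec_mulVec, Matrix.nonsing_inv_mul _ hu, Matrix.one_mulVec]
    rw [e, Matrix.mulVec_neg, ← Matrix.mulVec_mulVec, ← Matrix.mulVec_mulVec]
  refine Finset.sum_congr rfl fun x _ => ?_
  split_ifs with hx
  · rw [solve hθ, solve hθ', Pi.neg_apply, Pi.neg_apply,
      readout_mulVec_apply_congr Lc Q hQ M lev rs hrs hM n hQ₁₀ hτ₁ hτ₂ hN hW₀ hE (towerEquiv Lc M rs hrs (n + 1) x) X X' (fun b hb1 hb2 => ?_)]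
    rw [Equiv.symm_apply_apply] at hb1 hb2
    rw [← hx] at hX
    exact hX b hb1 hb2
  · rfl

end Readout

end Summit.QuantumFields.BalabanUV.Beta.FP.TorusNestedReadoutLocality

end
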